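import Summits.CriticalPhenomena.PercolationContinuityZ3.Theorems.SahiMasterFamilyOrShapeGF

/-!
# The OR-shape at every order, II: the merged-block expansion as a square-free coefficient

Unit `prim-master-conj` (crux anchor stmt-CriticalPhenomena-4575, helper work), gen 17; memo
`run/shared/lean/prim/prim-l12/prim-master-conj/POINTWISE.md` §18.  Continues `…OrShapeGF` (notation there).

For a set partition `π` of the tail slots `{0,…,n}` the MERGED family is `(A⁰, (B_C)_{C∈π})`, `B_C = ⋂_{j∈C} B_j`.  With
`ψ_k(s) := (−1)^{k+1}·k!·C(s,k) = s(1−s)(2−s)⋯(k−1−s)` (`≥ 0` on `[0,1]`), the MERGED EXPANSION is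
`M := Σ_π (∏_{C∈π} ψ_{|C|}(s)) · E_{|π|+1}(μ; 1_{A⁰}, (1_{B_C})_{C∈π})`.  We realise it through Sahi's polarisation at every monomial
(tree `coeff_one_sub_prod_binomB_genB`, [Sahi2008, Prop. 12 and §3.2]) applied to the "universal merged family" indexed by the nonempty
subsets `σ ⊆ {0,…,n+1}` of ALL slots: slot `{0}` carries `1_{A⁰}`, a block `σ ∌ 0` carries `ψ_{|σ|}(s)·1_{B_σ}`, blocks `σ ∋ 0`, `σ ≠ {0}` carry `0`.
In square-free language `Σ_{σ∌0} ψ_{|σ|}(s) x^σ 1_{B_σ}(ω) = 1 − (1 − X_ω)^s` (`one_sub_binomB_lin_coeff`), and the head extraction of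
`…OrShapeGF` gives (`merged_eq_coeff`)

  `M = Σ_{T} E_T = [x^{univ}] Ĝ · Σ_ω μ⁰(ω) 1_{A⁰}(ω) (1 − X_ω)^{−s}`,   `Ĝ = ∏_ω (1−X_ω)^{s μ⁰(ω)}`,

the sum over the block families `T` of all slots; `T ∌ {0}` contribute `0`, the others `(∏_{σ∈T, σ≠{0}} ψ_{|σ|}(s))` times the merged Sahi
functional (`sahiEOn_merged_eq_smul`); the all-singletons family gives `s^{n+1}·E_{n+2}(μ⁰; 1_{A⁰}, 1_B)` (`sahiEOn_merged_singletons`).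
HONEST FRAMING: identities/bookkeeping only.  Axioms standard. [this work]
-/

set_option autoImplicit false

open Finset

open private SqFree.ext coeff_add coeff_sub coeff_one coeff_mul coeff_sum coeff_single coeff_C_mul coeff_C coeff_neg
  isNil_single isNil_lin IsNil.add IsNil.sub IsNil.mul_left IsNil.neg IsNil.sum IsNil.emb
  binomB_zero_right prod_binomB_add_sqzero emb_binomB emb_inv1 coeff_univ_single_zero_mul_emb coeff_emb_univ coeff_emb
  C_mul_single single_mul_single_self mem_pre pre_map_succEmb rch_one
  from Literature.Combinatorics.Sahi2008.CumulationCone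

open private coeff_lin_pow from Literature.Combinatorics.Sahi2008.FKGCumulation

open private coeff_genB from Literature.Combinatorics.Sahi2008.GeneratingFunction

noncomputable section

open scoped Classical

namespace Summit.CriticalPhenomena.PercolationContinuityZ3.Theorems

namespace OrShape

open Function
open Literature.Combinatorics.Sahi2008
open Literature.Combinatorics.Sahi2008.SqFree
open Literature.Probability.Percolation.DecisionTree (ind ind_of_mem ind_of_not_mem ind_nonneg)

/-! ### `ψ_k(s) = (−1)^{k+1} k! C(s,k)` and `1 − (1−X)^s` -/

section Psi

/-- `ψ_1(s) = s`. [folklore] -/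
theorem psi_one (s : ℝ) : (-1 : ℝ) ^ (1 + 1) * rch 1 s * ((1 : ℕ).factorial : ℝ) = s := by
  rw [rch_one]; norm_num

/-- `ψ_k(s) ≥ 0` for `k ≥ 1`, `0 ≤ s ≤ 1`. [folklore; cf. Sahi2008, proof of Lemma 16] -/
theorem psi_nonneg {s : ℝ} (h0 : 0 ≤ s) (h1 : s ≤ 1) {k : ℕ} (hk : 1 ≤ k) :
    0 ≤ (-1 : ℝ) ^ (k + 1) * rch k s * (k.factorial : ℝ) := by
  obtain ⟨j, rfl⟩ := Nat.exists_eq_add_of_le' hk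
  have h := neg_one_pow_mul_rch_succ_nonneg h0 h1 j
  have e : (-1 : ℝ) ^ (j + 1 + 1) = (-1) ^ j := by rw [pow_succ, pow_succ]; ring
  rw [e]
  exact mul_nonneg h (Nat.cast_nonneg _)

variable {ι : Type} [Fintype ι] {n : ℕ}

omit [Fintype ι] in
/-- Indicator of a finite intersection is the product of indicators. [folklore] -/
theorem ind_biInter (B : Fin (n + 1) → Set (Set ι)) (ρ : Finset (Fin (n + 1))) (ω : Set ι) :
    ind (⋂ j ∈ ρ, B j) ω = ∏ j ∈ ρ, ind (B j) ω := by
  induction ρ using Finset.induction_on with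
  | empty => simp [ind]
  | insert j ρ hj ih =>
    rw [Finset.prod_insert hj, ← ih, ← Literature.Probability.Percolation.BHK2006.ind_inter]
    congr 1
    ext ω'
    simp

omit [Fintype ι] in
/-- **`1 − (1 − X_ω)^s = Σ_{ρ≠∅} ψ_{|ρ|}(s)·1_{B_ρ}(ω)·x^ρ`**: the coefficients of `1 − binomB s (lin (ind ∘ B) ω)`. [this work] -/
theorem one_sub_binomB_lin_coeff (s : ℝ) (B : Fin (n + 1) → Set (Set ι)) (ω : Set ι) (ρ : Finset (Fin (n + 1))) :
    (1 - binomB s (lin (fun j => ind (B j)) ω)).coeff ρ =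
      if ρ = ∅ then 0 else (-1 : ℝ) ^ (ρ.card + 1) * rch ρ.card s * (ρ.card.factorial : ℝ) * ind (⋂ j ∈ ρ, B j) ω := by
  rw [binomB_eq_one_sub, sub_sub_cancel, coeff_sum]
  simp only [coeff_C_mul, coeff_lin_pow, Fintype.card_fin]
  by_cases hρ : ρ = ∅
  · rw [if_pos hρ]
    refine Finset.sum_eq_zero fun k _ => ?_
    rw [if_neg, mul_zero]
    rw [hρ, Finset.card_empty]; omega
  · rw [if_neg hρ]
    have hc : 0 < ρ.card := Finset.card_pos.mpr (Finset.nonempty_iff_ne_empty.mpr hρ)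
    rw [Finset.sum_eq_single (ρ.card - 1)]
    · have e1 : ρ.card - 1 + 1 = ρ.card := Nat.sub_add_cancel hc
      rw [if_pos e1.symm, e1, ind_biInter]
      have e2 : (-1 : ℝ) ^ (ρ.card + 1) = (-1) ^ (ρ.card - 1) := by
        conv_lhs => rw [← e1]
        rw [pow_succ, pow_succ]; ring
      rw [e2]; ring
    · intro k _ hk
      rw [if_neg, mul_zero]
      omega
    · intro hk
      exfalso
      rw [Finset.mem_range] at hk
      have := ρ.card_le_univ
      rw [Fintype.card_fin] at this
      omega

end Psi

/-! ### The universal merged family and its generating function -/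

section Merged

variable {ι : Type} [Fintype ι] (p : ι → unitInterval) (e : ι) {n : ℕ} (A : Set (Set ι)) (B : Fin (n + 1) → Set (Set ι))

omit [Fintype ι] in
/-- **The universal merged family's square-free element is `x_0·1_{A⁰}(ω) + (1 − (1−X_ω)^s)`** (shifted by one slot). [this work] -/
theorem genB_merged_eq (s : ℝ) (ω : Set ι) :
    genB (fun (σ' : NEFinset (Fin (n + 2))) (ω : Set ι) =>
        (if σ'.1 = {0} then (1 : ℝ) else if (0 : Fin (n + 2)) ∈ σ'.1 then 0
          else (-1 : ℝ) ^ (σ'.1.card + 1) * rch σ'.1.card s * (σ'.1.card.factorial : ℝ)) *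
        ind (if σ'.1 = {0} then secAt e false A else if (0 : Fin (n + 2)) ∈ σ'.1 then (∅ : Set (Set ι))
          else ⋂ j ∈ SqFree.pre σ'.1, B j) ω) ω =
      single {0} (ind (secAt e false A) ω) + emb (1 - binomB s (lin (fun j => ind (B j)) ω)) := by
  refine SqFree.ext fun τ => ?_
  rw [coeff_genB, coeff_add, coeff_single, coeff_emb, one_sub_binomB_lin_coeff]
  by_cases hτ : τ.Nonempty
  · rw [dif_pos hτ]
    simp only [Subtype.coe_mk]
    by_cases h0 : τ = {0}
    · subst h0
      simp
    · rw [if_neg h0, if_neg h0, if_neg h0]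
      by_cases hz : (0 : Fin (n + 2)) ∈ τ
      · simp [hz]
      · simp only [hz, if_false, zero_add]
        have hpre : SqFree.pre τ ≠ ∅ := by
          intro hemp
          obtain ⟨i, hi⟩ := hτ
          have hi0 : i ≠ 0 := fun h => hz (h ▸ hi)
          obtain ⟨j, rfl⟩ := Fin.exists_succ_eq.mpr hi0
          have : j ∈ SqFree.pre τ := mem_pre.mpr hi
          rw [hemp] at this
          exact Finset.notMem_empty j this
        have hcard : (SqFree.pre τ).card = τ.card := by
          have hmap : (SqFree.pre τ).map (Fin.succEmb (n + 1)) = τ := by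
            ext i
            rw [Finset.mem_map]
            constructor
            · rintro ⟨j, hj, rfl⟩; exact mem_pre.mp hj
            · intro hi
              have hi0 : i ≠ 0 := fun h => hz (h ▸ hi)
              obtain ⟨j, rfl⟩ := Fin.exists_succ_eq.mpr hi0
              exact ⟨j, mem_pre.mpr hi, rfl⟩
          rw [← Finset.card_map (Fin.succEmb (n + 1)), hmap]
        rw [if_neg hpre, hcard]
  · rw [dif_neg hτ]
    have hτe : τ = ∅ := Finset.not_nonempty_iff_eq_empty.mp hτ
    subst hτe
    simp [SqFree.pre]

/-- **The merged expansion as a top square-free coefficient**: summing Sahi's functionals of the universal merged family over the block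
families of all slots (polarisation, [Sahi2008, Prop. 12, §3.2]) gives `[x^{univ}] Ĝ·Σ_ω μ⁰(ω)1_{A⁰}(ω)(1−X_ω)^{−s}`. [this work] -/
theorem merged_eq_coeff (s : ℝ) :
    ∑ T ∈ blockFamilies (univ : Finset (Fin (n + 2))),
        sahiEOn (bernoulliWeight (update p e 0)) T (fun (σ' : NEFinset (Fin (n + 2))) (ω : Set ι) =>
          (if σ'.1 = {0} then (1 : ℝ) else if (0 : Fin (n + 2)) ∈ σ'.1 then 0
            else (-1 : ℝ) ^ (σ'.1.card + 1) * rch σ'.1.card s * (σ'.1.card.factorial : ℝ)) *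
          ind (if σ'.1 = {0} then secAt e false A else if (0 : Fin (n + 2)) ∈ σ'.1 then (∅ : Set (Set ι))
            else ⋂ j ∈ SqFree.pre σ'.1, B j) ω) =
      ((∏ ω, binomB (s * bernoulliWeight (update p e 0) ω) (lin (fun j => ind (B j)) ω)) *
        ∑ ω, C (bernoulliWeight (update p e 0) ω * ind (secAt e false A) ω) *
          binomB (-s) (lin (fun j => ind (B j)) ω)).coeff univ := by
  rw [← coeff_one_sub_prod_binomB_genB _ (sum_bernoulliWeight (update p e 0))]
  set μ0 : Set ι → ℝ := bernoulliWeight (update p e 0) with hμ0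
  set X : Set ι → SqFree (Fin (n + 1)) ℝ := fun ω => lin (fun j => ind (B j)) ω with hX
  have hXnil : ∀ ω, (X ω).IsNil := fun ω => isNil_lin _ ω
  set W : Set ι → SqFree (Fin (n + 1)) ℝ := fun ω => 1 - binomB s (X ω) with hW
  have hWnil : ∀ ω, (W ω).IsNil := fun ω => isNil_one_sub_binomB' (hXnil ω) s
  have hgen : ∀ ω ∈ (univ : Finset (Set ι)),
      binomB (μ0 ω) (genB (fun (σ' : NEFinset (Fin (n + 2))) (ω : Set ι) =>
          (if σ'.1 = {0} then (1 : ℝ) else if (0 : Fin (n + 2)) ∈ σ'.1 then 0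
            else (-1 : ℝ) ^ (σ'.1.card + 1) * rch σ'.1.card s * (σ'.1.card.factorial : ℝ)) *
          ind (if σ'.1 = {0} then secAt e false A else if (0 : Fin (n + 2)) ∈ σ'.1 then (∅ : Set (Set ι))
            else ⋂ j ∈ SqFree.pre σ'.1, B j) ω) ω) =
        binomB (μ0 ω) (emb (W ω) + single {0} (ind (secAt e false A) ω)) := by
    intro ω _
    rw [genB_merged_eq]
    congr 1
    exact add_comm _ _
  set G' : SqFree (Fin (n + 1)) ℝ := ∏ ω, binomB (μ0 ω * s) (X ω) with hG'
  have hP : ∏ ω, binomB (μ0 ω) (emb (W ω)) = emb G' := by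
    rw [hG', map_prod]
    refine Finset.prod_congr rfl fun ω _ => ?_
    rw [← emb_binomB (hWnil ω), hW]
    simp only []
    rw [binomB_comp (hXnil ω)]
  rw [Finset.prod_congr rfl hgen,
    prod_binomB_add_sqzero univ μ0 (fun ω => emb (W ω)) (fun ω => single {0} (ind (secAt e false A) ω))
      (fun ω => IsNil.emb (hWnil ω)) (fun ω => isNil_single (singleton_nonempty _) _)
      (fun ω ω' => single_mul_single_self (singleton_nonempty _) _ _), hP]
  have hinv : ∀ ω, inv1 (emb (W ω)) = emb (binomB (-s) (X ω)) := by
    intro ω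
    rw [← emb_inv1 (hWnil ω), ← binomB_neg_one (hWnil ω), hW]
    simp only []
    rw [binomB_comp (hXnil ω), neg_one_mul]
  have : (1 : SqFree (Fin (n + 2)) ℝ) - emb G' * (1 - ∑ ω, C (μ0 ω) * single {0} (ind (secAt e false A) ω) * inv1 (emb (W ω)))
      = (1 - emb G') + ∑ ω, emb G' * (C (μ0 ω) * single {0} (ind (secAt e false A) ω) * inv1 (emb (W ω))) := by
    rw [mul_sub, mul_one, Finset.mul_sum]; ring
  rw [this, coeff_add, coeff_sub, coeff_one, if_neg (Finset.univ_nonempty.ne_empty), coeff_emb_univ,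
    sub_zero, zero_add, coeff_sum]
  -- right-hand side
  have hG'G : (∏ ω, binomB (s * μ0 ω) (X ω)) = G' := by
    rw [hG']; exact Finset.prod_congr rfl fun ω _ => by rw [mul_comm]
  rw [hG'G, Finset.mul_sum, coeff_sum']
  refine Finset.sum_congr rfl fun ω _ => ?_
  rw [hinv ω, C_mul_single]
  have h1 : emb G' * (single {0} (μ0 ω * ind (secAt e false A) ω) * emb (binomB (-s) (X ω)))
      = single {0} (μ0 ω * ind (secAt e false A) ω) * emb (G' * binomB (-s) (X ω)) := by
    rw [map_mul]; ring
  rw [h1, coeff_univ_single_zero_mul_emb, mul_left_comm, coeff_C_mul']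

/-! ### Unpacking the block-family sum: the block `{0}`, the `ψ`-factors, the all-singletons family -/

/-- The block `{0}` (the head slot alone). [this work] -/
theorem zeroBlock_mem_iff (T : Finset (NEFinset (Fin (n + 2)))) :
    (⟨{0}, singleton_nonempty 0⟩ : NEFinset (Fin (n + 2))) ∈ T ↔ ∃ σ' ∈ T, σ'.1 = {0} := by
  constructor
  · intro h; exact ⟨_, h, rfl⟩
  · rintro ⟨σ', hσ', h⟩
    have : σ' = ⟨{0}, singleton_nonempty 0⟩ := Subtype.ext h
    rwa [this] at hσ'

/-- A block family of all slots NOT containing the block `{0}` contributes `0`: its block through `0` carries the zero function.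
[this work] -/
theorem sahiEOn_merged_eq_zero (μ : Set ι → ℝ) (s : ℝ) {T : Finset (NEFinset (Fin (n + 2)))}
    (hT : T ∈ blockFamilies (univ : Finset (Fin (n + 2)))) (h0 : (⟨{0}, singleton_nonempty 0⟩ : NEFinset (Fin (n + 2))) ∉ T) :
    sahiEOn μ T (fun (σ' : NEFinset (Fin (n + 2))) (ω : Set ι) =>
        (if σ'.1 = {0} then (1 : ℝ) else if (0 : Fin (n + 2)) ∈ σ'.1 then 0
          else (-1 : ℝ) ^ (σ'.1.card + 1) * rch σ'.1.card s * (σ'.1.card.factorial : ℝ)) *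
        ind (if σ'.1 = {0} then secAt e false A else if (0 : Fin (n + 2)) ∈ σ'.1 then (∅ : Set (Set ι))
          else ⋂ j ∈ SqFree.pre σ'.1, B j) ω) = 0 := by
  obtain ⟨_, hcover⟩ := mem_blockFamilies.mp hT
  have h0u : (0 : Fin (n + 2)) ∈ T.biUnion Subtype.val := by rw [hcover]; exact mem_univ _
  obtain ⟨σ', hσ'T, h0σ'⟩ := Finset.mem_biUnion.mp h0u
  have hne : σ'.1 ≠ {0} := fun h => h0 ((zeroBlock_mem_iff T).mpr ⟨σ', hσ'T, h⟩)
  refine sahiEOn_eq_zero_of_eq_zero μ hσ'T ?_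
  funext ω
  rw [if_neg hne, if_pos h0σ', zero_mul]
  rfl

/-- **The `ψ`-factors come out**: for a block family containing the block `{0}`, the universal merged functional is
`(∏_{σ ≠ {0}} ψ_{|σ|}(s))` times the Sahi functional of the merged indicator family. [this work] -/
theorem sahiEOn_merged_eq_smul (μ : Set ι → ℝ) (s : ℝ) {T : Finset (NEFinset (Fin (n + 2)))}
    (h0 : (⟨{0}, singleton_nonempty 0⟩ : NEFinset (Fin (n + 2))) ∈ T) :
    sahiEOn μ T (fun (σ' : NEFinset (Fin (n + 2))) (ω : Set ι) =>
        (if σ'.1 = {0} then (1 : ℝ) else if (0 : Fin (n + 2)) ∈ σ'.1 then 0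
          else (-1 : ℝ) ^ (σ'.1.card + 1) * rch σ'.1.card s * (σ'.1.card.factorial : ℝ)) *
        ind (if σ'.1 = {0} then secAt e false A else if (0 : Fin (n + 2)) ∈ σ'.1 then (∅ : Set (Set ι))
          else ⋂ j ∈ SqFree.pre σ'.1, B j) ω) =
      (∏ σ' ∈ T.erase ⟨{0}, singleton_nonempty 0⟩, (-1 : ℝ) ^ (σ'.1.card + 1) * rch σ'.1.card s * (σ'.1.card.factorial : ℝ)) *
        sahiEOn μ T (fun (σ' : NEFinset (Fin (n + 2))) =>
          ind (if σ'.1 = {0} then secAt e false A else if (0 : Fin (n + 2)) ∈ σ'.1 then (∅ : Set (Set ι))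
            else ⋂ j ∈ SqFree.pre σ'.1, B j)) := by
  -- the scalar attached to a block (with `1` on `{0}`; the `0 ∈ σ ≠ {0}` blocks carry the zero function anyway)
  set cc : NEFinset (Fin (n + 2)) → ℝ := fun σ' =>
    if σ'.1 = {0} then (1 : ℝ) else (-1 : ℝ) ^ (σ'.1.card + 1) * rch σ'.1.card s * (σ'.1.card.factorial : ℝ) with hcc
  have hfun : (fun (σ' : NEFinset (Fin (n + 2))) (ω : Set ι) =>
        (if σ'.1 = {0} then (1 : ℝ) else if (0 : Fin (n + 2)) ∈ σ'.1 then 0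
          else (-1 : ℝ) ^ (σ'.1.card + 1) * rch σ'.1.card s * (σ'.1.card.factorial : ℝ)) *
        ind (if σ'.1 = {0} then secAt e false A else if (0 : Fin (n + 2)) ∈ σ'.1 then (∅ : Set (Set ι))
          else ⋂ j ∈ SqFree.pre σ'.1, B j) ω) =
      fun σ' => cc σ' • (ind (if σ'.1 = {0} then secAt e false A else if (0 : Fin (n + 2)) ∈ σ'.1 then (∅ : Set (Set ι))
          else ⋂ j ∈ SqFree.pre σ'.1, B j)) := by
    funext σ' ω
    simp only [hcc, Pi.smul_apply, smul_eq_mul]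
    by_cases h1 : σ'.1 = {0}
    · simp [h1]
    · rw [if_neg h1, if_neg h1, if_neg h1]
      by_cases hz : (0 : Fin (n + 2)) ∈ σ'.1
      · simp [hz, ind]
      · rw [if_neg hz, if_neg hz]
  rw [hfun]
  unfold sahiEOn
  rw [show (fun i : Fin T.card => (fun σ' => cc σ' • ind (if σ'.1 = {0} then secAt e false A
      else if (0 : Fin (n + 2)) ∈ σ'.1 then (∅ : Set (Set ι)) else ⋂ j ∈ SqFree.pre σ'.1, B j)) ((T.equivFin.symm i : T) : NEFinset (Fin (n + 2)))) =
      fun i => (fun i => cc ((T.equivFin.symm i : T) : NEFinset (Fin (n + 2)))) i •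
        (fun i => ind (if ((T.equivFin.symm i : T) : NEFinset (Fin (n + 2))).1 = {0} then secAt e false A
          else if (0 : Fin (n + 2)) ∈ ((T.equivFin.symm i : T) : NEFinset (Fin (n + 2))).1 then (∅ : Set (Set ι))
          else ⋂ j ∈ SqFree.pre ((T.equivFin.symm i : T) : NEFinset (Fin (n + 2))).1, B j)) i from rfl,
    sahiE_smul_family]
  congr 1
  -- the product of the scalars over the enumeration is the product over `T`, and the block `{0}` contributes `1`
  have hprod : ∏ i : Fin T.card, cc ((T.equivFin.symm i : T) : NEFinset (Fin (n + 2))) = ∏ σ' ∈ T, cc σ' := by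
    rw [← Finset.prod_coe_sort T]
    exact Fintype.prod_equiv T.equivFin.symm _ _ fun i => rfl
  rw [hprod, ← Finset.mul_prod_erase T cc h0]
  have hz : cc ⟨{0}, singleton_nonempty 0⟩ = 1 := by simp [hcc]
  rw [hz, one_mul]
  refine Finset.prod_congr rfl fun σ' hσ' => ?_
  have hne : σ'.1 ≠ {0} := by
    intro h
    exact (Finset.mem_erase.mp hσ').1 (Subtype.ext h)
  simp [hcc, hne]

/-- The all-singletons block family of all slots. [this work] -/
theorem singletons_mem_blockFamilies :
    (univ : Finset (Fin (n + 2))).map ⟨fun i => (⟨{i}, singleton_nonempty i⟩ : NEFinset (Fin (n + 2))),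
        fun _ _ h => Finset.singleton_inj.mp (congrArg Subtype.val h)⟩ ∈ blockFamilies (univ : Finset (Fin (n + 2))) := by
  rw [mem_blockFamilies]
  constructor
  · intro σ hσ σ' hσ' hne
    rw [Finset.mem_map] at hσ hσ'
    obtain ⟨i, _, rfl⟩ := hσ
    obtain ⟨j, _, rfl⟩ := hσ'
    change Disjoint ({i} : Finset (Fin (n + 2))) {j}
    rw [Finset.disjoint_singleton_left, Finset.mem_singleton]
    intro hij; subst hij; exact hne rfl
  · ext i
    simp only [Finset.mem_biUnion, Finset.mem_map, Finset.mem_univ, true_and, Function.Embedding.coeFn_mk, iff_true]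
    exact ⟨⟨{i}, singleton_nonempty i⟩, ⟨i, rfl⟩, Finset.mem_singleton_self i⟩

/-- The block `{0}` belongs to the all-singletons family. [this work] -/
theorem zeroBlock_mem_singletons :
    (⟨{0}, singleton_nonempty 0⟩ : NEFinset (Fin (n + 2))) ∈
      (univ : Finset (Fin (n + 2))).map ⟨fun i => (⟨{i}, singleton_nonempty i⟩ : NEFinset (Fin (n + 2))),
        fun _ _ h => Finset.singleton_inj.mp (congrArg Subtype.val h)⟩ :=
  Finset.mem_map.mpr ⟨0, mem_univ _, rfl⟩

/-- The `ψ`-factor of the all-singletons family is `s^{n+1}`. [this work] -/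
theorem prod_psi_singletons (s : ℝ) :
    ∏ σ' ∈ ((univ : Finset (Fin (n + 2))).map ⟨fun i => (⟨{i}, singleton_nonempty i⟩ : NEFinset (Fin (n + 2))),
        fun _ _ h => Finset.singleton_inj.mp (congrArg Subtype.val h)⟩).erase ⟨{0}, singleton_nonempty 0⟩,
      (-1 : ℝ) ^ (σ'.1.card + 1) * rch σ'.1.card s * (σ'.1.card.factorial : ℝ) = s ^ (n + 1) := by
  rw [Finset.prod_congr rfl (g := fun _ => s)]
  · rw [Finset.prod_const, Finset.card_erase_of_mem zeroBlock_mem_singletons, Finset.card_map, Finset.card_univ, Fintype.card_fin]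
    rfl
  · intro σ' hσ'
    obtain ⟨i, _, rfl⟩ := Finset.mem_map.mp (Finset.mem_erase.mp hσ').2
    simp only [Function.Embedding.coeFn_mk, Finset.card_singleton]
    exact psi_one s

/-- **The all-singletons term is the `0`-section family**: the merged indicator functional of the all-singletons block family is
`E_{n+2}(μ; 1_{A⁰}, 1_{B_0}, …, 1_{B_n})`. [this work] -/
theorem sahiEOn_merged_singletons (μ : Set ι → ℝ) :
    sahiEOn μ ((univ : Finset (Fin (n + 2))).map ⟨fun i => (⟨{i}, singleton_nonempty i⟩ : NEFinset (Fin (n + 2))),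
        fun _ _ h => Finset.singleton_inj.mp (congrArg Subtype.val h)⟩)
      (fun (σ' : NEFinset (Fin (n + 2))) =>
        ind (if σ'.1 = {0} then secAt e false A else if (0 : Fin (n + 2)) ∈ σ'.1 then (∅ : Set (Set ι))
          else ⋂ j ∈ SqFree.pre σ'.1, B j)) =
      sahiE μ (n + 2) (Matrix.vecCons (ind (secAt e false A)) (fun j => ind (B j))) := by
  set emb0 : Fin (n + 2) ↪ NEFinset (Fin (n + 2)) := ⟨fun i => (⟨{i}, singleton_nonempty i⟩ : NEFinset (Fin (n + 2))),
        fun _ _ h => Finset.singleton_inj.mp (congrArg Subtype.val h)⟩ with hemb0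
  set T₁ := (univ : Finset (Fin (n + 2))).map emb0 with hT₁
  -- an enumeration of `T₁` by `Fin (n+2)`
  have hbij : Function.Bijective (fun i : Fin (n + 2) => (⟨emb0 i, Finset.mem_map_of_mem emb0 (mem_univ i)⟩ : T₁)) := by
    constructor
    · intro i j h
      exact emb0.injective (congrArg Subtype.val h)
    · rintro ⟨σ', hσ'⟩
      obtain ⟨i, _, rfl⟩ := Finset.mem_map.mp hσ'
      exact ⟨i, rfl⟩
  set e₂ : Fin (n + 2) ≃ T₁ := Equiv.ofBijective _ hbij with he₂
  have hcard : T₁.card = n + 2 := by rw [hT₁, Finset.card_map, Finset.card_univ, Fintype.card_fin]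
  have key := sahiE_comp_equiv_eq_sahiEOn μ T₁ (fun (σ' : NEFinset (Fin (n + 2))) =>
        ind (if σ'.1 = {0} then secAt e false A else if (0 : Fin (n + 2)) ∈ σ'.1 then (∅ : Set (Set ι))
          else ⋂ j ∈ SqFree.pre σ'.1, B j)) ((finCongr hcard).trans e₂)
  rw [← key]
  have hfam : (fun i : Fin T₁.card => (fun (σ' : NEFinset (Fin (n + 2))) =>
        ind (if σ'.1 = {0} then secAt e false A else if (0 : Fin (n + 2)) ∈ σ'.1 then (∅ : Set (Set ι))
          else ⋂ j ∈ SqFree.pre σ'.1, B j)) ((((finCongr hcard).trans e₂) i : T₁) : NEFinset (Fin (n + 2)))) =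
      fun i => (Matrix.vecCons (ind (secAt e false A)) (fun j => ind (B j)) : Fin (n + 2) → Set ι → ℝ) (Fin.cast hcard i) := by
    funext i
    simp only [Equiv.trans_apply, finCongr_apply, he₂, Equiv.ofBijective_apply, hemb0, Function.Embedding.coeFn_mk]
    generalize Fin.cast hcard i = k
    refine Fin.cases ?_ (fun j => ?_) k
    · simp
    · have h1 : ({j.succ} : Finset (Fin (n + 2))) ≠ {0} := by
        intro h; exact Fin.succ_ne_zero j (Finset.singleton_injective h)
      have h2 : (0 : Fin (n + 2)) ∉ ({j.succ} : Finset (Fin (n + 2))) := by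
        rw [Finset.mem_singleton]; exact (Fin.succ_ne_zero j).symm
      have h3 : SqFree.pre ({j.succ} : Finset (Fin (n + 2))) = {j} := by
        ext i
        rw [mem_pre, Finset.mem_singleton, Finset.mem_singleton]
        exact Fin.succ_inj
      simp only [h1, h2, if_false, h3, Matrix.cons_val_succ]
      congr 1
      ext ω; simp
  rw [hfam, SahiTotalCumulance.sahiE_cast' μ hcard]

end Merged

end OrShape
end Summit.CriticalPhenomena.PercolationContinuityZ3.Theorems
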